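import Summits.HubbardSuperconductivity.HubbardSuperconductivity.Theorems.AnisotropyChordTransferFibre3TwoHoleBSNearWindowThresholds
import Mathlib.Analysis.Complex.ExponentialBounds

/-!
# Route `AnisotropyChord` / H0 rotor rung: HOLE₂(.75) near pairs for EVERY `L ≥ 8192` — the scalar threshold inequality discharged by a dyadic-block induction

Nineteenth file of the `TwoHoleBS` (PROP BS) chain.  `…TwoHoleBSNearWindowThresholds.dualCert_near_window_<d>` certifies the pair
class `d` at side `L ≥ 12` under ONE scalar inequality `ε♯(L,d)·K_d ≤ mLow_d(H_{⌊L/2⌋}/π + 1.52)`.  On the dyadic block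
`2^k ≤ L < 2^{k+1}`: `ln L ≤ (k+1)·0.6931471808` (`Real.log_two_lt_d9`), `1/L² ≤ 1/4^k`, `(k−1)·0.6931471803/3.141593 + 1.52 ≤ Λup(L)
≤ (1 + k·0.6931471808)/3.141592 + 1.52` (`log_add_one_le_harmonic`, `harmonic_le_one_add_log`, `Real.pi_gt_d6`, `Real.pi_lt_d6`), so the
inequality follows from the block inequality `Eblk k ≤ Mblk k`, which holds at `k = 13` (numerics) and propagates (`Eblk(k+1) ≤ 0.27·Eblk k`,
`Mblk(k+1) ≥ 0.94·Mblk k`):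
* `c2hi`, `c2lo`, `piLo`, `piHi`, `LamHi`, `LamLo`, `Eblk`, `Mblk`; `errSharp_le_Eblk`, `LamLo_le_capUp`, `capUp_le_LamHi`, `Mblk_le_mLow`,
  `Eblk_succ_le`, `Mblk_succ_ge`, ★ `Eblk_le_Mblk_of_base` (induction), `block_of_le` (every `L ≥ 2^13` sits in a block `k ≥ 13`);
* ★★ `thr_of_base` (block base at `k = 13` + class constants ⇒ the scalar hypothesis for every `L ≥ 8192`); the six class
  instances `dualCert_near_window_<d>_allL` (**`∀ L ≥ 8192, ∀ z, DualCert L (¾ε₁) z (z + d)`**) are in `…NearWindowAllLClasses`.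
Prover seat `hubbard-h0-rotor-p2` g3; helper for stmt-HubbardSuperconductivity-19089 (`--supports`, helper class).
WHAT THIS IS NOT: nothing here proves superconductivity in the Hubbard model; the rotor TARGET as originally worded stays
FALSE (g15 verdict).  Six near-pair classes (one orientation each; the `D₄` images follow by `…TwoHoleBSCovariance`) of ONE input
(HOLE₂(.75)) of ONE conditional reduction (rung 19089), for `L ≥ 8192`; per-`L` certificates exist for `9 ≤ L ≤ 36` — the range
`37 ≤ L < 8192`, the overlapping-cross classes `(1,0),(1,1),(2,0)` and far pairs remain.  Mathlib + tree imports only; no sorry, no axioms.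
-/

set_option linter.dupNamespace false
set_option autoImplicit false

namespace Summit.HubbardSuperconductivity.HubbardSuperconductivity.Theorems.AnisotropyChord.Transfer.Fibre3

namespace TwoHoleBS

open scoped BigOperators

/-! ## Block constants -/

/-- upper rational bound of `ln 2`. [folklore] -/
noncomputable def c2hi : ℝ := 0.6931471808
/-- lower rational bound of `ln 2`. [folklore] -/
noncomputable def c2lo : ℝ := 0.6931471803
/-- lower rational bound of `π`. [folklore] -/
noncomputable def piLo : ℝ := 3.141592
/-- upper rational bound of `π`. [folklore] -/
noncomputable def piHi : ℝ := 3.141593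

/-- upper bound of the capacity parameter on the block `k`. [folklore] -/
noncomputable def LamHi (k : ℕ) : ℝ := (1 + (k : ℝ) * c2hi) / piLo + 152 / 100
/-- lower bound of the capacity parameter on the block `k` (`k ≥ 1`). [folklore] -/
noncomputable def LamLo (k : ℕ) : ℝ := 152 / 100 + ((k : ℝ) - 1) * c2lo / piHi
/-- block majorant of `ε♯(L,d)·K`. [folklore] -/
noncomputable def Eblk (ρ K : ℝ) (k : ℕ) : ℝ :=
  (2 * (ρ * (11.71 * (((k : ℝ) + 1) * c2hi) + 5.9)) + 1722) / (4 : ℝ) ^ k * K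
/-- block minorant of `mLow`. [folklore] -/
noncomputable def Mblk (g sl su X : ℝ) (k : ℕ) : ℝ :=
  (su / (LamHi k * su - 1)) * g / (8 * (g + X / (sl * (LamLo k * sl - 1))))

/-! ## The block bounds -/

/-- on `2^k ≤ L < 2^{k+1}`: `ε♯(L,d)·K ≤ Eblk`. [folklore] -/
theorem errSharp_le_Eblk (L : ℕ) (k : ℕ) (hkL : 2 ^ k ≤ L) (hLk : L < 2 ^ (k + 1)) (d : ℤ × ℤ) (K : ℝ) (hK : 0 ≤ K) :
    (2 * (rhoMax d * (11.71 * Real.log L + 5.9) / (L : ℝ) ^ 2) + 1722 / (L : ℝ) ^ 2) * K ≤ Eblk (rhoMax d) K k := by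
  have hρ := rhoMax_nonneg d
  have hLpos : (0 : ℝ) < L := by
    have : 0 < 2 ^ k := pow_pos two_pos k
    exact_mod_cast lt_of_lt_of_le this hkL
  have hL1 : (1 : ℝ) ≤ L := by exact_mod_cast (show 1 ≤ L from le_trans Nat.one_le_two_pow hkL)
  have hlog0 : 0 ≤ Real.log L := Real.log_nonneg hL1
  -- `ln L ≤ (k+1)·c2hi`
  have hlog : Real.log L ≤ ((k : ℝ) + 1) * c2hi := by
    have h1 : Real.log L ≤ Real.log ((2 : ℝ) ^ (k + 1)) := by
      apply Real.log_le_log hLpos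
      exact_mod_cast hLk.le
    rw [Real.log_pow] at h1
    have h2 : Real.log 2 ≤ c2hi := Real.log_two_lt_d9.le
    have h3 : ((k + 1 : ℕ) : ℝ) * Real.log 2 ≤ ((k : ℝ) + 1) * c2hi := by
      push_cast
      exact mul_le_mul_of_nonneg_left h2 (by positivity)
    linarith
  -- `4^k ≤ L²`
  have hsq : (4 : ℝ) ^ k ≤ (L : ℝ) ^ 2 := by
    have h1 : ((2 ^ k : ℕ) : ℝ) ≤ L := by exact_mod_cast hkL
    have h2 : (4 : ℝ) ^ k = ((2 : ℝ) ^ k) ^ 2 := by rw [← pow_mul, mul_comm, pow_mul]; norm_num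
    rw [h2]
    push_cast at h1
    exact pow_le_pow_left₀ (by positivity) h1 2
  have h4pos : (0 : ℝ) < (4 : ℝ) ^ k := by positivity
  unfold Eblk
  refine mul_le_mul_of_nonneg_right ?_ hK
  have e : 2 * (rhoMax d * (11.71 * Real.log L + 5.9) / (L : ℝ) ^ 2) + 1722 / (L : ℝ) ^ 2
      = (2 * (rhoMax d * (11.71 * Real.log L + 5.9)) + 1722) / (L : ℝ) ^ 2 := by ring
  rw [e]
  have hnum : 2 * (rhoMax d * (11.71 * Real.log L + 5.9)) + 1722
      ≤ 2 * (rhoMax d * (11.71 * (((k : ℝ) + 1) * c2hi) + 5.9)) + 1722 := by nlinarith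
  have hnum0 : 0 ≤ 2 * (rhoMax d * (11.71 * (((k : ℝ) + 1) * c2hi) + 5.9)) + 1722 := by
    have : 0 ≤ c2hi := by norm_num [c2hi]
    positivity
  calc (2 * (rhoMax d * (11.71 * Real.log L + 5.9)) + 1722) / (L : ℝ) ^ 2
      ≤ (2 * (rhoMax d * (11.71 * (((k : ℝ) + 1) * c2hi) + 5.9)) + 1722) / (L : ℝ) ^ 2 :=
        div_le_div_of_nonneg_right hnum (by positivity)
    _ ≤ _ := div_le_div_of_nonneg_left hnum0 h4pos hsq

/-- on `2^k ≤ L < 2^{k+1}`, `k ≥ 1`: `LamLo k ≤ H_{⌊L/2⌋}/π + 1.52`. [folklore] -/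
theorem LamLo_le_capUp (L : ℕ) (k : ℕ) (hk : 1 ≤ k) (hkL : 2 ^ k ≤ L) :
    LamLo k ≤ (harmonic (L / 2) : ℝ) / Real.pi + 152 / 100 := by
  have hpi := Real.pi_lt_d6
  have hpi0 := Real.pi_pos
  -- `(k−1) ln 2 ≤ log (L/2 + 1) ≤ H_{L/2}`
  have hn : 2 ^ (k - 1) ≤ L / 2 := by
    have : 2 ^ k = 2 * 2 ^ (k - 1) := by
      rw [← pow_succ']; congr 1; omega
    omega
  have h1 := log_add_one_le_harmonic (L / 2)
  push_cast at h1
  have h2 : ((k : ℝ) - 1) * c2lo ≤ Real.log (((L / 2 : ℕ) : ℝ) + 1) := by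
    have hlt : ((2 : ℝ) ^ (k - 1)) ≤ ((L / 2 : ℕ) : ℝ) + 1 := by
      exact_mod_cast (by omega : 2 ^ (k - 1) ≤ L / 2 + 1)
    have h3 : Real.log ((2 : ℝ) ^ (k - 1)) ≤ Real.log (((L / 2 : ℕ) : ℝ) + 1) := Real.log_le_log (by positivity) hlt
    rw [Real.log_pow] at h3
    have h4 : c2lo ≤ Real.log 2 := Real.log_two_gt_d9.le
    have hk1 : ((k - 1 : ℕ) : ℝ) = (k : ℝ) - 1 := by
      rw [Nat.cast_sub hk]; push_cast; ring
    rw [hk1] at h3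
    have hk0 : (0 : ℝ) ≤ (k : ℝ) - 1 := by
      have : (1 : ℝ) ≤ k := by exact_mod_cast hk
      linarith
    nlinarith
  have h5 : ((k : ℝ) - 1) * c2lo ≤ (harmonic (L / 2) : ℝ) := h2.trans h1
  have hc : 0 ≤ ((k : ℝ) - 1) * c2lo := by
    have : (1 : ℝ) ≤ k := by exact_mod_cast hk
    have : 0 ≤ c2lo := by norm_num [c2lo]
    nlinarith
  unfold LamLo
  have h6 : ((k : ℝ) - 1) * c2lo / piHi ≤ (harmonic (L / 2) : ℝ) / Real.pi := by
    rw [div_le_div_iff₀ (by norm_num [piHi]) hpi0]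
    have : Real.pi ≤ piHi := by norm_num [piHi]; linarith
    nlinarith [h5, this]
  linarith

/-- on `2^k ≤ L < 2^{k+1}`, `k ≥ 1`: `H_{⌊L/2⌋}/π + 1.52 ≤ LamHi k`. [folklore] -/
theorem capUp_le_LamHi (L : ℕ) (k : ℕ) (hk : 1 ≤ k) (hkL : 2 ^ k ≤ L) (hLk : L < 2 ^ (k + 1)) :
    (harmonic (L / 2) : ℝ) / Real.pi + 152 / 100 ≤ LamHi k := by
  have hpi := Real.pi_gt_d6
  have hn1 : 1 ≤ L / 2 := by
    have : 2 ≤ 2 ^ k := by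
      calc 2 = 2 ^ 1 := by norm_num
        _ ≤ 2 ^ k := Nat.pow_le_pow_right (by norm_num) hk
    omega
  have hn2 : L / 2 < 2 ^ k := by
    have : 2 ^ (k + 1) = 2 * 2 ^ k := by rw [pow_succ']
    omega
  have h1 := harmonic_le_one_add_log (L / 2)
  have h2 : Real.log ((L / 2 : ℕ) : ℝ) ≤ (k : ℝ) * c2hi := by
    have hpos : (0 : ℝ) < ((L / 2 : ℕ) : ℝ) := by exact_mod_cast hn1
    have h3 : Real.log ((L / 2 : ℕ) : ℝ) ≤ Real.log ((2 : ℝ) ^ k) := by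
      apply Real.log_le_log hpos
      exact_mod_cast hn2.le
    rw [Real.log_pow] at h3
    have h4 : Real.log 2 ≤ c2hi := Real.log_two_lt_d9.le
    nlinarith
  have hH : (harmonic (L / 2) : ℝ) ≤ 1 + (k : ℝ) * c2hi := by linarith
  have hH0 : (0 : ℝ) ≤ (harmonic (L / 2) : ℝ) := by exact_mod_cast (harmonic_pos (by omega)).le
  unfold LamHi
  have h6 : (harmonic (L / 2) : ℝ) / Real.pi ≤ (1 + (k : ℝ) * c2hi) / piLo := by
    rw [div_le_div_iff₀ Real.pi_pos (by norm_num [piLo])]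
    have : piLo ≤ Real.pi := by norm_num [piLo]; linarith
    have hpl : (0 : ℝ) ≤ piLo := by norm_num [piLo]
    nlinarith
  linarith

/-- `Mblk ≤ mLow` when `LamLo k ≤ Λ ≤ LamHi k` (all denominators positive). [folklore] -/
theorem Mblk_le_mLow (g sl su X Λ : ℝ) (k : ℕ) (hg : 0 < g) (hsl : 0 < sl) (hsu : 0 < su) (hX : 0 ≤ X)
    (hlo : LamLo k ≤ Λ) (hhi : Λ ≤ LamHi k) (h1 : 1 < LamLo k * sl) (h2 : 1 < LamLo k * su) :
    Mblk g sl su X k ≤ mLow g sl su X Λ := by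
  unfold Mblk mLow
  have hΛsl : 1 < Λ * sl := lt_of_lt_of_le h1 (by nlinarith)
  have hΛsu : 1 < Λ * su := lt_of_lt_of_le h2 (by nlinarith)
  have hHsu : 1 < LamHi k * su := lt_of_lt_of_le hΛsu (by nlinarith)
  have ha : su / (LamHi k * su - 1) ≤ su / (Λ * su - 1) :=
    div_le_div_of_nonneg_left hsu.le (by linarith) (by nlinarith)
  have hmono : sl * (LamLo k * sl - 1) ≤ sl * (Λ * sl - 1) := by
    nlinarith [mul_nonneg (mul_nonneg hsl.le hsl.le) (sub_nonneg.mpr hlo)]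
  have hb : X / (sl * (Λ * sl - 1)) ≤ X / (sl * (LamLo k * sl - 1)) :=
    div_le_div_of_nonneg_left hX (by nlinarith) hmono
  have hbnn : 0 ≤ X / (sl * (Λ * sl - 1)) := div_nonneg hX (by nlinarith)
  have hann : 0 ≤ su / (LamHi k * su - 1) := div_nonneg hsu.le (by linarith)
  calc su / (LamHi k * su - 1) * g / (8 * (g + X / (sl * (LamLo k * sl - 1))))
      ≤ su / (LamHi k * su - 1) * g / (8 * (g + X / (sl * (Λ * sl - 1)))) := by
        refine div_le_div_of_nonneg_left (by positivity) (by positivity) ?_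
        nlinarith
    _ ≤ su / (Λ * su - 1) * g / (8 * (g + X / (sl * (Λ * sl - 1)))) :=
        div_le_div_of_nonneg_right (mul_le_mul_of_nonneg_right ha hg.le) (by positivity)

/-! ## The geometric propagation of the block inequality -/

/-- `Eblk (k+1) ≤ 0.27·Eblk k` for `k ≥ 13`. [folklore] -/
theorem Eblk_succ_le (ρ K : ℝ) (hρ : 0 ≤ ρ) (hK : 0 ≤ K) (k : ℕ) (hk : 13 ≤ k) :
    Eblk ρ K (k + 1) ≤ (27 / 100) * Eblk ρ K k := by
  unfold Eblk
  push_cast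
  have hc : 0 < c2hi := by norm_num [c2hi]
  have hk' : (13 : ℝ) ≤ k := by exact_mod_cast hk
  have h4 : (0 : ℝ) < (4 : ℝ) ^ k := by positivity
  have hN0 : 0 ≤ 2 * (ρ * (11.71 * (((k : ℝ) + 1) * c2hi) + 5.9)) + 1722 := by positivity
  have hgrow : 2 * (ρ * (11.71 * (((k : ℝ) + 1 + 1) * c2hi) + 5.9)) + 1722
      ≤ (108 / 100) * (2 * (ρ * (11.71 * (((k : ℝ) + 1) * c2hi) + 5.9)) + 1722) := by
    nlinarith [mul_nonneg hρ hc.le, mul_nonneg (mul_nonneg hρ hc.le) (by linarith : (0:ℝ) ≤ (k:ℝ) - 13)]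
  rw [pow_succ]
  calc (2 * (ρ * (11.71 * (((k : ℝ) + 1 + 1) * c2hi) + 5.9)) + 1722) / ((4 : ℝ) ^ k * 4) * K
      = ((2 * (ρ * (11.71 * (((k : ℝ) + 1 + 1) * c2hi) + 5.9)) + 1722) * K) / ((4 : ℝ) ^ k * 4) := by ring
    _ ≤ ((108 / 100) * (2 * (ρ * (11.71 * (((k : ℝ) + 1) * c2hi) + 5.9)) + 1722) * K) / ((4 : ℝ) ^ k * 4) :=
        div_le_div_of_nonneg_right (mul_le_mul_of_nonneg_right hgrow hK) (by positivity)
    _ = 27 / 100 * ((2 * (ρ * (11.71 * (((k : ℝ) + 1) * c2hi) + 5.9)) + 1722) / (4 : ℝ) ^ k * K) := by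
        field_simp
        ring

/-- `Mblk (k+1) ≥ 0.94·Mblk k` for `k ≥ 13`, `1.3 ≤ su`, positivity side conditions. [folklore] -/
theorem Mblk_succ_ge (g sl su X : ℝ) (hg : 0 < g) (hsl : 0 < sl) (hsu : 13 / 10 ≤ su) (hX : 0 ≤ X)
    (h1 : 1 < LamLo 13 * sl) (k : ℕ) (hk : 13 ≤ k) :
    (94 / 100) * Mblk g sl su X k ≤ Mblk g sl su X (k + 1) := by
  unfold Mblk
  have hk' : (13 : ℝ) ≤ k := by exact_mod_cast hk
  have hc : 0 < c2hi := by norm_num [c2hi]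
  have hcl : 0 < c2lo := by norm_num [c2lo]
  have hLamHi13 : (47 : ℝ) / 10 ≤ LamHi k := by
    unfold LamHi c2hi piLo
    have : (1 + (k : ℝ) * 0.6931471808) / 3.141592 ≥ (1 + 13 * 0.6931471808) / 3.141592 := by
      apply div_le_div_of_nonneg_right _ (by norm_num); nlinarith
    norm_num at this ⊢; linarith
  have hLamHi_succ : LamHi (k + 1) = LamHi k + c2hi / piLo := by
    unfold LamHi; push_cast; ring
  have hδ : c2hi / piLo ≤ (2207 : ℝ) / 10000 := by norm_num [c2hi, piLo]
  have hpH : (0 : ℝ) < piHi := by norm_num [piHi]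
  have hLamLo_mono : LamLo k ≤ LamLo (k + 1) := by
    unfold LamLo; push_cast
    have : ((k : ℝ) - 1) * c2lo / piHi ≤ ((k : ℝ) + 1 - 1) * c2lo / piHi :=
      div_le_div_of_nonneg_right (by nlinarith) hpH.le
    linarith
  have hLamLo13 : LamLo 13 ≤ LamLo k := by
    unfold LamLo; push_cast
    have : ((13 : ℝ) - 1) * c2lo / piHi ≤ ((k : ℝ) - 1) * c2lo / piHi :=
      div_le_div_of_nonneg_right (by nlinarith) hpH.le
    linarith
  -- positivity of denominators
  have hsl1 : 1 < LamLo k * sl := lt_of_lt_of_le h1 (by nlinarith)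
  have hsl2 : 1 < LamLo (k + 1) * sl := lt_of_lt_of_le hsl1 (by nlinarith)
  have hsu0 : 0 < su := by linarith
  have hsuk : 1 < LamHi k * su := by nlinarith
  have hsuk1 : 1 < LamHi (k + 1) * su := by rw [hLamHi_succ]; nlinarith [div_nonneg hc.le (show (0:ℝ) ≤ piLo by norm_num [piLo])]
  -- (a) the `su`-factor loses at most 6 %
  have ha : (94 / 100) * (su / (LamHi k * su - 1)) ≤ su / (LamHi (k + 1) * su - 1) := by
    rw [hLamHi_succ]
    have hδ0 : 0 ≤ c2hi / piLo := div_nonneg hc.le (by norm_num [piLo])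
    have hD1 : 0 < LamHi k * su - 1 := by linarith
    have hD2 : 0 < (LamHi k + c2hi / piLo) * su - 1 := by nlinarith
    have hstep : (745 : ℝ) / 10000 ≤ (6 / 100) * LamHi k - (94 / 100) * (c2hi / piLo) := by linarith
    have hprod : (13 / 10) * ((745 : ℝ) / 10000) ≤ su * ((6 / 100) * LamHi k - (94 / 100) * (c2hi / piLo)) :=
      mul_le_mul hsu hstep (by norm_num) hsu0.le
    have hD : (94 / 100) * ((LamHi k + c2hi / piLo) * su - 1) ≤ LamHi k * su - 1 := by nlinarith
    rw [mul_div_assoc', div_le_div_iff₀ hD1 hD2]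
    nlinarith [mul_nonneg hsu0.le (sub_nonneg.mpr hD)]
  -- (b) the denominator only decreases
  have hmono : sl * (LamLo k * sl - 1) ≤ sl * (LamLo (k + 1) * sl - 1) := by
    nlinarith [mul_nonneg (mul_nonneg hsl.le hsl.le) (sub_nonneg.mpr hLamLo_mono)]
  have hb : X / (sl * (LamLo (k + 1) * sl - 1)) ≤ X / (sl * (LamLo k * sl - 1)) :=
    div_le_div_of_nonneg_left hX (by nlinarith) hmono
  have hbpos : 0 < 8 * (g + X / (sl * (LamLo (k + 1) * sl - 1))) := by
    have : 0 ≤ X / (sl * (LamLo (k + 1) * sl - 1)) := div_nonneg hX (by nlinarith)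
    positivity
  have hann : 0 ≤ su / (LamHi (k + 1) * su - 1) := div_nonneg hsu0.le (by linarith)
  calc (94 / 100) * (su / (LamHi k * su - 1) * g / (8 * (g + X / (sl * (LamLo k * sl - 1)))))
      = ((94 / 100) * (su / (LamHi k * su - 1))) * g / (8 * (g + X / (sl * (LamLo k * sl - 1)))) := by ring
    _ ≤ (su / (LamHi (k + 1) * su - 1)) * g / (8 * (g + X / (sl * (LamLo k * sl - 1)))) :=
        div_le_div_of_nonneg_right (mul_le_mul_of_nonneg_right ha hg.le) (by positivity)
    _ ≤ (su / (LamHi (k + 1) * su - 1)) * g / (8 * (g + X / (sl * (LamLo (k + 1) * sl - 1)))) := by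
        refine div_le_div_of_nonneg_left (by positivity) hbpos ?_
        nlinarith

/-- ★ the block inequality propagates from `k = 13` to every `k ≥ 13`. [folklore] -/
theorem Eblk_le_Mblk_of_base (ρ K g sl su X : ℝ) (hρ : 0 ≤ ρ) (hK : 0 ≤ K) (hg : 0 < g) (hsl : 0 < sl)
    (hsu : 13 / 10 ≤ su) (hX : 0 ≤ X) (h1 : 1 < LamLo 13 * sl) (hbase : Eblk ρ K 13 ≤ Mblk g sl su X 13)
    (k : ℕ) (hk : 13 ≤ k) : Eblk ρ K k ≤ Mblk g sl su X k := by
  induction k with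
  | zero => omega
  | succ n ih =>
    rcases Nat.lt_or_ge n 13 with hn | hn
    · have : n + 1 = 13 := by omega
      rw [this]; exact hbase
    · have hE := Eblk_succ_le ρ K hρ hK n hn
      have hM := Mblk_succ_ge g sl su X hg hsl hsu hX h1 n hn
      have hMn : 0 ≤ Mblk g sl su X n := by
        have hEn : 0 ≤ Eblk ρ K n := by
          unfold Eblk
          have : 0 ≤ c2hi := by norm_num [c2hi]
          positivity
        exact hEn.trans (ih hn)
      nlinarith [ih hn]

/-- every `L ≥ 2^13` lies in a dyadic block `k ≥ 13`. [folklore] -/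
theorem block_of_le (L : ℕ) (hL : 8192 ≤ L) : ∃ k : ℕ, 13 ≤ k ∧ 2 ^ k ≤ L ∧ L < 2 ^ (k + 1) := by
  refine ⟨Nat.log 2 L, ?_, Nat.pow_log_le_self 2 (by omega), Nat.lt_pow_succ_log_self (by norm_num) L⟩
  exact Nat.le_log_of_pow_le (by norm_num) (by norm_num; omega)

/-- ★★ generic all-`L` form: block base inequality at `k = 13` + the class constants ⇒ the scalar hypothesis for every `L ≥ 8192`. [folklore] -/
theorem thr_of_base (L : ℕ) (hL : 8192 ≤ L) (d : ℤ × ℤ) (K g sl su X : ℝ) (hK : 0 ≤ K) (hg : 0 < g) (hsl : 0 < sl)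
    (hsu : 13 / 10 ≤ su) (hX : 0 ≤ X) (h1 : 1 < LamLo 13 * sl) (h2 : 1 < LamLo 13 * su)
    (hbase : Eblk (rhoMax d) K 13 ≤ Mblk g sl su X 13) :
    (2 * (rhoMax d * (11.71 * Real.log L + 5.9) / (L : ℝ) ^ 2) + 1722 / (L : ℝ) ^ 2) * K
      ≤ mLow g sl su X ((harmonic (L / 2) : ℝ) / Real.pi + 152 / 100) := by
  obtain ⟨k, hk, hkL, hLk⟩ := block_of_le L hL
  have hE := errSharp_le_Eblk L k hkL hLk d K hK
  have hB := Eblk_le_Mblk_of_base (rhoMax d) K g sl su X (rhoMax_nonneg d) hK hg hsl hsu hX h1 hbase k hk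
  have hlo := LamLo_le_capUp L k (by omega) hkL
  have hhi := capUp_le_LamHi L k (by omega) hkL hLk
  have hLamLo13 : LamLo 13 ≤ LamLo k := by
    unfold LamLo; push_cast
    have hk' : (13 : ℝ) ≤ k := by exact_mod_cast hk
    have hpH : (0 : ℝ) < piHi := by norm_num [piHi]
    have hcl : (0 : ℝ) ≤ c2lo := by norm_num [c2lo]
    have : ((13 : ℝ) - 1) * c2lo / piHi ≤ ((k : ℝ) - 1) * c2lo / piHi :=
      div_le_div_of_nonneg_right (by nlinarith) hpH.le
    linarith
  have h1k : 1 < LamLo k * sl := lt_of_lt_of_le h1 (by nlinarith)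
  have h2k : 1 < LamLo k * su := lt_of_lt_of_le h2 (by nlinarith)
  have hM := Mblk_le_mLow g sl su X _ k hg hsl (by linarith) hX hlo hhi h1k h2k
  linarith

end TwoHoleBS

end Summit.HubbardSuperconductivity.HubbardSuperconductivity.Theorems.AnisotropyChord.Transfer.Fibre3
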